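import Literature.NumberTheory.Irrationality.Zudilin2014.FirstTaleLemma7
import Summits.KontsevichZagierPeriods.Zeta5Search.TwoTaleP15Residue

/-!
# The two-tale point P15: first-tale arithmetic in the kernel (Zudilin 2014, Lemma 7 at P15)

HONEST FRAMING: systematic search; no irrationality claim unless certified.

Cell pub-zeta5, T3 service (fam-measure's two-tale `ζ(2)` programme, `families/measure/FAMILY.md` §2.5; fam-denom D16
`Denom/TwoTaleP15Saving`).  The point **P15**: `a = (13n+1, 11n+1, 9n+1, 15n+1)`, `b = (1, 2n+1, 4n+1, 26n+2)` of
Zudilin's first tale [Zudilin2014ZetaTwo, Section 3].  With the Literature formalisation of Proposition 1 and Lemma 7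
(`Literature/NumberTheory/Irrationality/Zudilin2014/FirstTale*.lean`) this file provides, as KERNEL theorems:

* `aP15`, `bP15`, `admissible`; the integers `qP15 n = q(a,b)` (`= formQZ`) and
  `pP15num n = D₁₅ₙ D₁₆ₙ · p(a,b)` (`= formPZ … (15n) (16n)`), with the cast identities to the printed rational forms;
  `amax = 15n+1`, `a2star = 11n+1`, `d = 16n−1`;
* `cell_rule` — for a permutation `σ` and a prime `p` with `26n < p²`, the exponent
  `ord_p Π(a,b)/Π(σa,b) = (⌊11x⌋−⌊13x⌋−⌊9x⌋−⌊5x⌋) − (⌊(26−α'₄)x⌋−⌊α'₁x⌋−⌊(α'₂−2)x⌋−⌊(α'₃−4)x⌋)`, `x = {n/p}`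
  (Lemma 7's `φ_σ`), read off from first Legendre digits, divides `qP15 n` and `pP15num n`;
* the CELLS: for each of the 15 intervals of fam-denom's table `ivl` on which the first tale alone reaches the level
  (`ivl 0,2,…,8` at level 1 incl. the part `[1/11, 3/13)` of `ivl 1`; `ivl 10,…,13,16,17,18` at level 2), split into
  40 sub-cells of constant digits, an explicit `σ ∈ S₄` with `φ_σ ≥ level` — theorems `cell_<i>_<k>` with hypotheses
  `u·p ≤ den·(n mod p)`, `(n mod p)·den' < v·p` and conclusion `p^level ∣ qP15 n ∧ p^level ∣ pP15num n`.
The remaining intervals (`ivl 9, 14, 15, 19` and `[3/13, 4/17) ⊂ ivl 1`) need the SECOND tale (Lemma 8) and the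
two-tale coincidence `(bmiss)@P15`; they are NOT claimed here.  Sub-cell table and witnesses: HOME
`code/p1/g9/p15_cells.py` (exact rationals; reproduces fam-denom's `ivl` table independently).
-/

noncomputable section

namespace Summit.KontsevichZagierPeriods.Zeta5Search.TwoTaleP15

open Finset
open Literature.NumberTheory.Irrationality.Zudilin2014
open Literature.NumberTheory.DiophantineApproximation (RhinViola.mul_div_eq_mul_div_add)

/-! ### The point P15 -/

/-- The slopes `α = (13, 11, 9, 15)` of `a_j = α_j n + 1`. -/
def αv : Fin 4 → ℕ := ![13, 11, 9, 15]

/-- `a = (13n+1, 11n+1, 9n+1, 15n+1)`. -/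
def aP15 (n : ℕ) : Fin 4 → ℤ := fun i => (αv i : ℤ) * n + 1

/-- `b = (1, 2n+1, 4n+1, 26n+2)`. -/
def bP15 (n : ℕ) : Fin 4 → ℤ := ![1, 2 * (n : ℤ) + 1, 4 * (n : ℤ) + 1, 26 * (n : ℤ) + 2]

/-- Evaluation lemma `αv_zero` (component of the parameter vector). -/
@[simp] theorem αv_zero : αv 0 = 13 := rfl
/-- Evaluation lemma `αv_one` (component of the parameter vector). -/
@[simp] theorem αv_one : αv 1 = 11 := rfl
/-- Evaluation lemma `αv_two` (component of the parameter vector). -/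
@[simp] theorem αv_two : αv 2 = 9 := rfl
/-- Evaluation lemma `αv_three` (component of the parameter vector). -/
@[simp] theorem αv_three : αv 3 = 15 := rfl
/-- Evaluation lemma `aP15_zero` (component of the parameter vector). -/
@[simp] theorem aP15_zero (n : ℕ) : aP15 n 0 = 13 * (n : ℤ) + 1 := by simp [aP15]
/-- Evaluation lemma `aP15_one` (component of the parameter vector). -/
@[simp] theorem aP15_one (n : ℕ) : aP15 n 1 = 11 * (n : ℤ) + 1 := by simp [aP15]
/-- Evaluation lemma `aP15_two` (component of the parameter vector). -/
@[simp] theorem aP15_two (n : ℕ) : aP15 n 2 = 9 * (n : ℤ) + 1 := by simp [aP15]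
/-- Evaluation lemma `aP15_three` (component of the parameter vector). -/
@[simp] theorem aP15_three (n : ℕ) : aP15 n 3 = 15 * (n : ℤ) + 1 := by simp [aP15]

/-- Bounds `9 ≤ α_i ≤ 15`. -/
theorem αv_bounds (i : Fin 4) : 9 ≤ αv i ∧ αv i ≤ 15 := by
  fin_cases i <;> decide

/-- `Σ α_i = 48`. -/
theorem sum_αv : ∑ i, αv i = 48 := by decide

/-- Evaluation lemma `bP15_zero` (component of the parameter vector). -/
@[simp] theorem bP15_zero (n : ℕ) : bP15 n 0 = 1 := rfl
/-- Evaluation lemma `bP15_one` (component of the parameter vector). -/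
@[simp] theorem bP15_one (n : ℕ) : bP15 n 1 = 2 * (n : ℤ) + 1 := rfl
/-- Evaluation lemma `bP15_two` (component of the parameter vector). -/
@[simp] theorem bP15_two (n : ℕ) : bP15 n 2 = 4 * (n : ℤ) + 1 := rfl
/-- Evaluation lemma `bP15_three` (component of the parameter vector). -/
@[simp] theorem bP15_three (n : ℕ) : bP15 n 3 = 26 * (n : ℤ) + 2 := rfl

/-- P15 is admissible for `n ≥ 1` (eq. (cond1): `b_j ≤ a_i < b₄`, `d = 16n − 1 ≥ 0`). -/
theorem admissible {n : ℕ} (hn : 1 ≤ n) : Admissible (aP15 n) (bP15 n) where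
  lower j hj i := by
    have hi : (9 : ℤ) * n + 1 ≤ aP15 n i := by fin_cases i <;> simp <;> omega
    fin_cases j <;> simp at hj ⊢ <;> linarith
  upper i := by
    have hi : aP15 n i ≤ 15 * (n : ℤ) + 1 := by fin_cases i <;> simp <;> omega
    simp only [bP15_three]; linarith
  balance := by
    simp only [Fin.sum_univ_four, bP15_zero, bP15_one, bP15_two, bP15_three, aP15_zero, aP15_one, aP15_two,
      aP15_three]
    omega

/-- `a₄* = 15n + 1`. -/
theorem amax_eq (n : ℕ) : amax (aP15 n) = 15 * (n : ℤ) + 1 := by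
  unfold amax; simp only [aP15_zero, aP15_one, aP15_two, aP15_three]; omega

/-- `a₂* = 11n + 1`. -/
theorem a2star_eq (n : ℕ) : a2star (aP15 n) = 11 * (n : ℤ) + 1 := by
  apply le_antisymm
  · unfold a2star
    refine sup'_le _ _ fun i _ => ?_
    by_cases hi : i = 1
    · subst hi
      calc minOthers (aP15 n) 1 ≤ aP15 n 2 := minOthers_le (aP15 n) (by decide)
        _ ≤ 11 * (n : ℤ) + 1 := by rw [aP15_two]; omega
    · calc minOthers (aP15 n) i ≤ aP15 n 1 := minOthers_le (aP15 n) (fun h => hi h.symm)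
        _ = 11 * (n : ℤ) + 1 := aP15_one n
  · have h : 11 * (n : ℤ) + 1 ≤ minOthers (aP15 n) 2 := by
      unfold minOthers
      refine le_inf' _ _ fun j hj => ?_
      have hj' : j ≠ 2 := (mem_erase.1 hj).1
      fin_cases j <;> simp at hj' ⊢ <;> omega
    exact h.trans (le_sup' (minOthers (aP15 n)) (mem_univ 2))

/-- `d = 16n − 1`. -/
theorem dExp_eq (n : ℕ) : dExp (aP15 n) (bP15 n) = 16 * n - 1 := by
  unfold dExp
  simp only [Fin.sum_univ_four, bP15_zero, bP15_one, bP15_two, bP15_three, aP15_zero, aP15_one, aP15_two,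
    aP15_three]
  omega

/-- **`q_n` at P15** (an integer): `q(a,b)` of Proposition 1. -/
def qP15 (n : ℕ) : ℤ := formQZ (aP15 n) (bP15 n)

/-- **`D₁₅ₙ D₁₆ₙ p_n` at P15** (an integer; Proposition 1 gives `D₁₅ₙ D₁₆ₙ p_n ∈ ℤ`). -/
def pP15num (n : ℕ) : ℤ := formPZ (aP15 n) (bP15 n) (15 * n) (16 * n)

/-- `qP15 n = q(a,b)`. -/
theorem qP15_cast {n : ℕ} (hn : 1 ≤ n) : (qP15 n : ℚ) = formQ (aP15 n) (bP15 n) :=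
  (formQ_eq_cast (admissible hn)).symm

/-- The denominator hypotheses of `formP_eq_cast` at P15 hold for every permutation of `a`. -/
theorem denom_hyps {n : ℕ} (hn : 1 ≤ n) (σ : Equiv.Perm (Fin 4)) :
    (∀ j : Fin 4, j ≠ 3 → ((aP15 n ∘ σ) j - bP15 n j).toNat ≤ 15 * n) ∧
      (bP15 n 3 - a2star (aP15 n) - 1).toNat ≤ 15 * n ∧ (bP15 n 3 - a2star (aP15 n) - 1).toNat ≤ 16 * n ∧
      dExp (aP15 n) (bP15 n) + 1 ≤ 16 * n := by
  refine ⟨fun j hj => ?_, ?_, ?_, ?_⟩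
  · have hb : 1 ≤ bP15 n j := by fin_cases j <;> simp at hj ⊢
    have ha : (aP15 n ∘ σ) j ≤ 15 * (n : ℤ) + 1 := by
      simp only [Function.comp_apply]
      generalize σ j = i
      fin_cases i <;> simp <;> omega
    omega
  · rw [a2star_eq, bP15_three]; omega
  · rw [a2star_eq, bP15_three]; omega
  · rw [dExp_eq]; omega

/-- `pP15num n = D₁₅ₙ D₁₆ₙ · p(a,b)`. -/
theorem pP15num_cast {n : ℕ} (hn : 1 ≤ n) :
    (pP15num n : ℚ) = (Nat.lcmUpto (15 * n) : ℚ) * Nat.lcmUpto (16 * n) * formP (aP15 n) (bP15 n) := by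
  have h := denom_hyps hn 1
  simp only [Equiv.Perm.coe_one, Function.comp_id] at h
  exact (formP_eq_cast (admissible hn) h.1 h.2.1 h.2.2.1 h.2.2.2).symm

/-! ### Lemma 7 at P15: the digit rule -/

/-- A permutation of `Fin 4` from a function and its inverse (both explicit; inverse laws by `decide`). -/
def mkPerm (f g : Fin 4 → Fin 4) (h₁ : ∀ i, g (f i) = i) (h₂ : ∀ i, f (g i) = i) : Equiv.Perm (Fin 4) :=
  ⟨f, g, h₁, h₂⟩

/-- Evaluation lemma `mkPerm_apply` (component of the parameter vector). -/
@[simp] theorem mkPerm_apply (f g : Fin 4 → Fin 4) (h₁ h₂) (i : Fin 4) : mkPerm f g h₁ h₂ i = f i := rfl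

/-- First Legendre digit bookkeeping: `⌊c n/p⌋ = c ⌊n/p⌋ + j` when `j p ≤ c (n mod p) < (j+1) p`. -/
theorem mul_div_eq_of_digit {c n p j : ℕ} (hp : 0 < p) (h₁ : j * p ≤ c * (n % p)) (h₂ : c * (n % p) < (j + 1) * p) :
    c * n / p = c * (n / p) + j := by
  rw [RhinViola.mul_div_eq_mul_div_add c n hp, Nat.div_eq_of_lt_le h₁ h₂]

/-- **The digit rule (Lemma 7 at P15, one permutation).**  Let `σ ∈ S₄` with slopes `α'_j = α_{σ j}`, written as
`α'₁ = c₀`, `α'₂ = c₁ + 2`, `α'₃ = c₂ + 4`, `α'₄ = 26 − c₃`; let `p` be a prime with `26n < p²` and first digits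
`j₁₁ = ⌊11x⌋, j₁₃, j₉, j₅`, `k₃ = ⌊c₃x⌋, k₀ = ⌊c₀x⌋, k₁, k₂` at `x = {n/p}`.  Then
`ord_p Π(a,b)/Π(σa,b) = (j₁₁−j₁₃−j₉−j₅) − (k₃−k₀−k₁−k₂)` and for every `e` below it, `p^e ∣ q_n` and
`p^e ∣ D₁₅ₙD₁₆ₙ p_n` (Zudilin 2014 Lemma 7, kernel form via `pow_dvd_formQZ` / `pow_dvd_formPZ`). -/
theorem cell_rule (σ : Equiv.Perm (Fin 4)) (c0 c1 c2 c3 : ℕ)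
    (hσ0 : αv (σ 0) = c0) (hσ1 : αv (σ 1) = c1 + 2) (hσ2 : αv (σ 2) = c2 + 4) (hσ3 : αv (σ 3) + c3 = 26)
    {n p : ℕ} (hn : 1 ≤ n) (hp : p.Prime) (hp2 : 26 * n < p ^ 2)
    (j11 j13 j9 j5 k3 k0 k1 k2 : ℕ)
    (h11 : j11 * p ≤ 11 * (n % p) ∧ 11 * (n % p) < (j11 + 1) * p)
    (h13 : j13 * p ≤ 13 * (n % p) ∧ 13 * (n % p) < (j13 + 1) * p)
    (h9 : j9 * p ≤ 9 * (n % p) ∧ 9 * (n % p) < (j9 + 1) * p)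
    (h5 : j5 * p ≤ 5 * (n % p) ∧ 5 * (n % p) < (j5 + 1) * p)
    (g3 : k3 * p ≤ c3 * (n % p) ∧ c3 * (n % p) < (k3 + 1) * p)
    (g0 : k0 * p ≤ c0 * (n % p) ∧ c0 * (n % p) < (k0 + 1) * p)
    (g1 : k1 * p ≤ c1 * (n % p) ∧ c1 * (n % p) < (k1 + 1) * p)
    (g2 : k2 * p ≤ c2 * (n % p) ∧ c2 * (n % p) < (k2 + 1) * p)
    {e : ℕ} (he : (e : ℤ) ≤ ((j11 : ℤ) - j13 - j9 - j5) - ((k3 : ℤ) - k0 - k1 - k2)) :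
    (p : ℤ) ^ e ∣ qP15 n ∧ (p : ℤ) ^ e ∣ pP15num n := by
  haveI : Fact p.Prime := ⟨hp⟩
  have hp0 : 0 < p := hp.pos
  have hadm := admissible hn
  -- the factorial arguments and their sizes
  have hsq : ∀ c : ℕ, c ≤ 26 → c * n < p ^ 2 := fun c hc => lt_of_le_of_lt (Nat.mul_le_mul_right n hc) hp2
  have hcsum : c0 + c1 + c2 = c3 + 16 := by
    have hs : ∑ i, αv (σ i) = 48 := by rw [Equiv.sum_comp σ αv]; exact sum_αv
    rw [Fin.sum_univ_four] at hs; omega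
  have hc3 : c3 ≤ 26 := by omega
  have hc0 : c0 ≤ 26 := by have := (αv_bounds (σ 0)).2; omega
  have hc1 : c1 ≤ 26 := by have := (αv_bounds (σ 1)).2; omega
  have hc2 : c2 ≤ 26 := by have := (αv_bounds (σ 2)).2; omega
  -- the parameter differences
  have t3 : (bP15 n 3 - aP15 n 3 - 1).toNat = 11 * n := by simp only [bP15_three, aP15_three]; omega
  have t0 : (aP15 n 0 - bP15 n 0).toNat = 13 * n := by simp only [bP15_zero, aP15_zero]; omega
  have t1 : (aP15 n 1 - bP15 n 1).toNat = 9 * n := by simp only [bP15_one, aP15_one]; omega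
  have t2 : (aP15 n 2 - bP15 n 2).toNat = 5 * n := by simp only [bP15_two, aP15_two]; omega
  have cast3 : (αv (σ 3) : ℤ) + c3 = 26 := by exact_mod_cast hσ3
  have s3 : (bP15 n 3 - (aP15 n ∘ σ) 3 - 1).toNat = c3 * n := by
    have e : bP15 n 3 - (aP15 n ∘ σ) 3 - 1 = ((c3 * n : ℕ) : ℤ) := by
      simp only [Function.comp_apply, aP15, bP15_three]; push_cast
      linear_combination (-(n : ℤ)) * cast3
    rw [e, Int.toNat_natCast]
  have s0 : ((aP15 n ∘ σ) 0 - bP15 n 0).toNat = c0 * n := by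
    have e : (aP15 n ∘ σ) 0 - bP15 n 0 = ((c0 * n : ℕ) : ℤ) := by
      simp only [Function.comp_apply, aP15, bP15_zero, hσ0]; push_cast; ring
    rw [e, Int.toNat_natCast]
  have s1 : ((aP15 n ∘ σ) 1 - bP15 n 1).toNat = c1 * n := by
    have e : (aP15 n ∘ σ) 1 - bP15 n 1 = ((c1 * n : ℕ) : ℤ) := by
      simp only [Function.comp_apply, aP15, bP15_one, hσ1]; push_cast; ring
    rw [e, Int.toNat_natCast]
  have s2 : ((aP15 n ∘ σ) 2 - bP15 n 2).toNat = c2 * n := by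
    have e : (aP15 n ∘ σ) 2 - bP15 n 2 = ((c2 * n : ℕ) : ℤ) := by
      simp only [Function.comp_apply, aP15, bP15_two, hσ2]; push_cast; ring
    rw [e, Int.toNat_natCast]
  -- the valuations
  have v1 := padicValRat_Pi_eq (p := p) (a := aP15 n) (b := bP15 n)
    (by rw [t3]; exact hsq 11 (by norm_num)) (by rw [t0]; exact hsq 13 (by norm_num))
    (by rw [t1]; exact hsq 9 (by norm_num)) (by rw [t2]; exact hsq 5 (by norm_num))
  have v2 := padicValRat_Pi_eq (p := p) (a := aP15 n ∘ σ) (b := bP15 n)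
    (by rw [s3]; exact hsq c3 hc3) (by rw [s0]; exact hsq c0 hc0) (by rw [s1]; exact hsq c1 hc1)
    (by rw [s2]; exact hsq c2 hc2)
  rw [t3, t0, t1, t2, mul_div_eq_of_digit hp0 h11.1 h11.2, mul_div_eq_of_digit hp0 h13.1 h13.2,
    mul_div_eq_of_digit hp0 h9.1 h9.2, mul_div_eq_of_digit hp0 h5.1 h5.2] at v1
  rw [s3, s0, s1, s2, mul_div_eq_of_digit hp0 g3.1 g3.2, mul_div_eq_of_digit hp0 g0.1 g0.2,
    mul_div_eq_of_digit hp0 g1.1 g1.2, mul_div_eq_of_digit hp0 g2.1 g2.2] at v2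
  have hval : (e : ℤ) ≤ padicValRat p (Pi (aP15 n) (bP15 n)) - padicValRat p (Pi (aP15 n ∘ σ) (bP15 n)) := by
    rw [v1, v2]
    have hcs : (c0 : ℤ) + c1 + c2 = c3 + 16 := by exact_mod_cast hcsum
    have key : ((c0 : ℤ) + c1 + c2) * ((n / p : ℕ) : ℤ) = ((c3 : ℤ) + 16) * ((n / p : ℕ) : ℤ) := by rw [hcs]
    have hexp : ((11 * (n / p) + j11 : ℕ) : ℤ) - ((13 * (n / p) + j13 : ℕ) : ℤ) - ((9 * (n / p) + j9 : ℕ) : ℤ)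
          - ((5 * (n / p) + j5 : ℕ) : ℤ)
        - (((c3 * (n / p) + k3 : ℕ) : ℤ) - ((c0 * (n / p) + k0 : ℕ) : ℤ) - ((c1 * (n / p) + k1 : ℕ) : ℤ)
          - ((c2 * (n / p) + k2 : ℕ) : ℤ))
        = ((j11 : ℤ) - j13 - j9 - j5) - ((k3 : ℤ) - k0 - k1 - k2) := by
      push_cast at key ⊢
      linear_combination key
    rw [hexp]
    exact he
  have hd := denom_hyps hn σ
  have hd1 := denom_hyps hn 1
  simp only [Equiv.Perm.coe_one, Function.comp_id] at hd1
  exact ⟨pow_dvd_formQZ hadm σ hval, pow_dvd_formPZ hadm σ hd1.1 hd.1 hd.2.1 hd.2.2.1 hd.2.2.2 hval⟩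

end Summit.KontsevichZagierPeriods.Zeta5Search.TwoTaleP15

end
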